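import Summits.KontsevichZagierPeriods.KontsevichZagierPeriods.Theses.HurwitzMicroSectors
import Literature.NumberTheory.Transcendental.BoxCoordinatePowerMap
import Literature.NumberTheory.Transcendental.BoxIntegralHurwitz
import Literature.NumberTheory.Transcendental.KZMellinFibres
import Literature.NumberTheory.Transcendental.KZLogCalculusProofs
import Literature.Barriers.KontsevichZagierPeriods.GrothendieckPeriodConjectureDependenceOddZetaProofs

/-!
# Sketch — crux `AperySectorThreeTwo` (stmt-KontsevichZagierPeriods-3873), ideator 3, round 1

First lemmas of the three idea cards, stated over existing declarations, plus the compositions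
that show each first lemma concludes the crux BY NAME.

* Card `flattening-dilation`: `dilationMove_holds` — the route's engine item `DilationMove`
  (stmt-3872) PROVED here from `BoxCoordinatePowerMap.lean` (ℚ-semialgebraicity via
  `isSemialgebraicMapOn_aeval`); `MonomialFlatten` (its instance `m = k + 1`, constant target) PROVED.
* Card `sector-parity-ladder`: `IsSectorRep`, `SectorRepExists`, `SectorAdd`, `SectorFlatten`,
  `SectorDouble`, `NormalFormExists`, `SectorKernel` (all elaborate) and the PROVED compositions
  `kernel_of_nf : NormalFormExists → SectorKernel`,
  `apery_of_kernel : SectorRepExists → SectorAdd → SectorKernel → AperySectorThreeTwo`.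
* Card `level-two-tower`: `LevelTwoTower` (generic dimension `n ≥ 2`, hypothesis
  `Irrational (zetaValue n)`), PROVED specialisations `apery_of_tower` (n = 3, Apéry in tree) and
  `evenSector_of_tower` (n = 2k, Lindemann in tree).
-/

noncomputable section

open MeasureTheory Set
open Literature.NumberTheory.Transcendental
open Literature.ModelTheory.ExponentialFields (IsSemialgebraic)

namespace Summit.KontsevichZagierPeriods.KontsevichZagierPeriods.Cruxes.AperySectorThreeTwo.Ideator3

open Summit.KontsevichZagierPeriods.KontsevichZagierPeriods.Theses.HurwitzMicroSectors
  (AperySectorThreeTwo DilationMove)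

/-! ## Card A — flattening-dilation -/

/-- The route's engine item `DilationMove` (stmt-KontsevichZagierPeriods-3872), PROVED from the
in-tree analytic file `BoxCoordinatePowerMap.lean`: the only missing ingredients were the
`ℚ`-semialgebraicity of `x ↦ (xᵢᵐ)ᵢ` (`isSemialgebraicMapOn_aeval`) and the packaging. -/
theorem dilationMove_holds : DilationMove := by
  intro n m hm r r' hr hr' hint
  have hm0 : m ≠ 0 := by omega
  refine ⟨n, r, r', BoxIntegral.coordPow m, BoxIntegral.coordPowDeriv m, ?_, ?_, ?_, ?_, ?_, rfl⟩
  · rw [hr]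
    have h := isSemialgebraicMapOn_aeval (k := ℚ) (R := ℝ) (KZ.isSemialgebraic_box n)
      (fun j => (MvPolynomial.X j : MvPolynomial (Fin n) ℚ) ^ m)
    refine h.congr fun x _ => ?_
    funext i
    simp [BoxIntegral.coordPow]
  · intro x _
    exact BoxIntegral.hasFDerivWithinAt_coordPow m _ x
  · rw [hr]
    exact BoxIntegral.injOn_coordPow_box hm0
  · rw [hr, hr']
    exact (BoxIntegral.image_coordPow_box hm0).symm
  · intro x hx
    have hx' : ∀ i, x i ∈ Ioo (0 : ℝ) 1 := by rw [hr] at hx; exact hx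
    rw [hint x hx, BoxIntegral.abs_det_coordPowDeriv hm0 hx']
    rfl

/-- **First lemma of card A (MonomialFlatten).** On the open cube, `[q·(k+1)³·tᵏ] − [q]` is ONE
change-of-variables move (`xᵢ ↦ xᵢ^{k+1}`, CONSTANT target): the monomial is integrated inside
rule 2), without Newton–Leibniz and without leaving dimension 3. -/
def MonomialFlatten : Prop :=
  ∀ (k : ℕ) (q : ℚ) (r r' : KZ.IntegralRep 3),
    r.domain = {x | ∀ i, x i ∈ Set.Ioo (0:ℝ) 1} → r'.domain = {x | ∀ i, x i ∈ Set.Ioo (0:ℝ) 1} →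
    Set.EqOn r.integrand (fun x => (q : ℝ) * (((k : ℝ) + 1) ^ 3 * (x 0 * x 1 * x 2) ^ k)) r.domain →
    Set.EqOn r'.integrand (fun _ => (q : ℝ)) r'.domain →
    KZ.of r - KZ.of r' ∈ KZ.changeOfVariablesRel

theorem monomialFlatten_holds : MonomialFlatten := by
  intro k q r r' hr hr' hi hi'
  refine dilationMove_holds 3 (k + 1) (by omega) r r' hr hr' fun x hx => ?_
  have hx' : ∀ i, x i ∈ Ioo (0 : ℝ) 1 := by rw [hr] at hx; exact hx
  have hmem : (fun i => x i ^ (k + 1)) ∈ r'.domain := by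
    rw [hr']
    exact fun i => ⟨pow_pos (hx' i).1 _, pow_lt_one₀ (hx' i).1.le (hx' i).2 (by omega)⟩
  rw [hi hx, hi' hmem, Fin.prod_univ_three]
  push_cast
  ring

/-! ## Card B — sector-parity-ladder: one constructor, three relations, two inductions -/

/-- The integrand of the `(3,2)` sector attached to `P ∈ ℚ[t]`, in the crux's literal typing. -/
def sectorFun (P : Polynomial ℚ) : (Fin 3 → ℝ) → ℝ :=
  fun x => Polynomial.aeval (x 0 * x 1 * x 2) P / (1 - (x 0 * x 1 * x 2) ^ 2)

/-- `r` is a sector representation of `P`: domain the open cube, integrand `P(t)/(1−t²)` on it.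
EVERY representation of the line is of this form: constants `q` are `sectorFun (C q * (1 − X²))`,
monomials `q tᵏ` are `sectorFun (C q * X^k * (1 − X²))`, the normal form `c + b/(1−t)` is
`sectorFun (C c * (1 − X²) + C b * (1 + X))`. -/
def IsSectorRep (r : KZ.IntegralRep 3) (P : Polynomial ℚ) : Prop :=
  r.domain = {x | ∀ i, x i ∈ Set.Ioo (0:ℝ) 1} ∧ Set.EqOn r.integrand (sectorFun P) r.domain

/-- The normal-form polynomial: `sectorFun (nfPoly c b) = c + b/(1 − t)` on the cube. -/
def nfPoly (c b : ℚ) : Polynomial ℚ :=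
  Polynomial.C c * (1 - Polynomial.X ^ 2) + Polynomial.C b * (1 + Polynomial.X)

/-- (E0) every `P` has a sector representation (semialgebraic: `isSemialgebraicFunOn_aeval_div_aeval`;
integrable: `BoxIntegral.integrableOn_box_prod_pow_div_one_sub_prod_pow`, finite sum). -/
def SectorRepExists : Prop := ∀ P : Polynomial ℚ, ∃ r : KZ.IntegralRep 3, IsSectorRep r P

/-- (E1) additivity of sector representations = ONE instance of `KZ.integrandAddRel`. -/
def SectorAdd : Prop :=
  ∀ (P Q : Polynomial ℚ) (r rP rQ : KZ.IntegralRep 3),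
    IsSectorRep r (P + Q) → IsSectorRep rP P → IsSectorRep rQ Q →
    KZ.of r - KZ.of rP - KZ.of rQ ∈ KZ.relations

/-- (E2) flattening in sector clothing: `[q(k+1)³ tᵏ] ∼ [q]` (card A: one dilation `m = k+1`). -/
def SectorFlatten : Prop :=
  ∀ (k : ℕ) (q : ℚ) (r r' : KZ.IntegralRep 3),
    IsSectorRep r (Polynomial.C (q * ((k : ℚ) + 1) ^ 3) * Polynomial.X ^ k * (1 - Polynomial.X ^ 2)) →
    IsSectorRep r' (Polynomial.C q * (1 - Polynomial.X ^ 2)) →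
    KZ.of r - KZ.of r' ∈ KZ.relations

/-- (E3) doubling: `[8q t/(1−t²)] ∼ [q/(1−t)]` (one dilation `m = 2`), i.e. `H₀ + H₁ ∼ 8H₁` with the
rational coefficient INSIDE the integrand (no division by integers is ever needed). -/
def SectorDouble : Prop :=
  ∀ (q : ℚ) (r r' : KZ.IntegralRep 3),
    IsSectorRep r (Polynomial.C (8 * q) * Polynomial.X) →
    IsSectorRep r' (Polynomial.C q * (1 + Polynomial.X)) →
    KZ.of r - KZ.of r' ∈ KZ.relations

/-- EXISTENTIAL normal form: proved from (E0)–(E3) by `Polynomial.induction_on'` (additivity) and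
`Nat.twoStepInduction` on the exponent with the parity ladder `t^{j+2} = t^j − t^j(1−t²)`; no
Euclidean division, no symbol map, no value computation. -/
def NormalFormExists : Prop :=
  ∀ (P : Polynomial ℚ) (r : KZ.IntegralRep 3), IsSectorRep r P →
    ∃ (c b : ℚ) (N : KZ.IntegralRep 3), IsSectorRep N (nfPoly c b) ∧ KZ.of r - KZ.of N ∈ KZ.relations

/-- KERNEL FORM of the crux on the sector: a value-zero sector representation is a relation. -/
def SectorKernel : Prop :=
  ∀ (P : Polynomial ℚ) (r : KZ.IntegralRep 3), IsSectorRep r P → r.value = 0 → KZ.of r ∈ KZ.relations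

/-- On the cube the normal-form integrand is `c + b/(1−t)`. -/
theorem sectorFun_nfPoly {c b : ℚ} {x : Fin 3 → ℝ} (hx : ∀ i, x i ∈ Ioo (0 : ℝ) 1) :
    sectorFun (nfPoly c b) x = c + b / (1 - x 0 * x 1 * x 2) := by
  have h := BoxIntegral.prod_mem_Ioo (n := 3) (by norm_num) hx
  rw [Fin.prod_univ_three] at h
  have h1 : (1 : ℝ) - x 0 * x 1 * x 2 ≠ 0 := by linarith [h.2]
  have h2 : (1 : ℝ) + x 0 * x 1 * x 2 ≠ 0 := by linarith [h.1]
  have h3 : (1 : ℝ) - (x 0 * x 1 * x 2) ^ 2 = (1 - x 0 * x 1 * x 2) * (1 + x 0 * x 1 * x 2) := by ring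
  simp only [sectorFun, nfPoly, map_add, map_mul, map_sub, map_pow, map_one, Polynomial.aeval_C,
    Polynomial.aeval_X, eq_ratCast]
  rw [h3]
  field_simp

/-- `NormalFormExists → SectorKernel`: soundness transports the value to the normal form, the
in-tree `box_integral_normalForm_weight_three` evaluates it to `c + bζ(3)`, the in-tree rigidity
`normalForm_weight_three_coeff_eq` (Apéry) gives `c = b = 0`, and a zero integrand is a relation. -/
theorem kernel_of_nf (hN : NormalFormExists) : SectorKernel := by
  intro P r hr hv
  obtain ⟨c, b, N, hNs, hrN⟩ := hN P r hr
  have hNv : N.value = 0 := by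
    have h := KZ.relations_le_ker_eval_holds hrN
    rw [AddMonoidHom.mem_ker, map_sub, KZ.eval_of, KZ.eval_of] at h
    linarith
  have hNv' : N.value = c + b * zetaValue 3 := by
    rw [KZ.IntegralRep.value, hNs.1, ← (BoxIntegral.box_integral_normalForm_weight_three (c : ℝ) b).2]
    refine setIntegral_congr_fun (BoxIntegral.measurableSet_box 3) fun x hx => ?_
    have hx' : x ∈ N.domain := by rw [hNs.1]; exact hx
    rw [hNs.2 hx', sectorFun_nfPoly hx]
  have hcb : c = 0 ∧ b = 0 :=
    BoxIntegral.normalForm_weight_three_coeff_eq (a := c) (b := b) (a' := 0) (b' := 0)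
      (by push_cast; linarith)
  obtain ⟨rfl, rfl⟩ := hcb
  have hN0 : KZ.of N ∈ KZ.relations := by
    refine KZ.of_mem_relations_of_eqOn_zero N fun x hx => ?_
    have hx' : ∀ i, x i ∈ Ioo (0 : ℝ) 1 := by rw [hNs.1] at hx; exact hx
    rw [hNs.2 hx, sectorFun_nfPoly hx']
    simp
  have : KZ.of r = (KZ.of r - KZ.of N) + KZ.of N := by abel
  rw [this]
  exact KZ.relations.add_mem hrN hN0

/-- `SectorRepExists → SectorAdd → SectorKernel → AperySectorThreeTwo` (difference trick): for the
two given representations, `[r] − [d] − [r']` is one additivity move with `d` a sector rep of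
`P − P'`; soundness gives `d.value = 0`; the kernel form kills `[d]`. -/
theorem apery_of_kernel (hE : SectorRepExists) (hA : SectorAdd) (hK : SectorKernel) :
    AperySectorThreeTwo := by
  intro r r' P P' hr hr' hi hi' hv
  obtain ⟨d, hd⟩ := hE (P - P')
  have hrP : IsSectorRep r ((P - P') + P') := by
    rw [sub_add_cancel]
    exact ⟨hr, hi⟩
  have h1 : KZ.of r - KZ.of d - KZ.of r' ∈ KZ.relations := hA (P - P') P' r d r' hrP hd ⟨hr', hi'⟩
  have h2 : d.value = 0 := by
    have h := KZ.relations_le_ker_eval_holds h1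
    rw [AddMonoidHom.mem_ker, map_sub, map_sub, KZ.eval_of, KZ.eval_of, KZ.eval_of] at h
    linarith
  have h3 : KZ.of d ∈ KZ.relations := hK (P - P') d hd h2
  have : KZ.of r - KZ.of r' = (KZ.of r - KZ.of d - KZ.of r') + KZ.of d := by abel
  show KZ.of r - KZ.of r' ∈ KZ.relations
  rw [this]
  exact KZ.relations.add_mem h1 h3

/-- The whole of card B in one line: the crux from (E0), (E1) and the existential normal form. -/
theorem apery_of_nf (hE : SectorRepExists) (hA : SectorAdd) (hN : NormalFormExists) :
    AperySectorThreeTwo :=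
  apery_of_kernel hE hA (kernel_of_nf hN)

/-! ### Card B, executed: (E0)–(E3) PROVED, the parity ladder PROVED, hence the crux -/

section Proofs

open Polynomial (C X)

theorem box_t_mem {x : Fin 3 → ℝ} (hx : ∀ i, x i ∈ Ioo (0 : ℝ) 1) :
    0 < x 0 * x 1 * x 2 ∧ x 0 * x 1 * x 2 < 1 := by
  have h := BoxIntegral.prod_mem_Ioo (n := 3) (by norm_num) hx
  rw [Fin.prod_univ_three] at h
  exact h

theorem one_sub_sq_ne_zero {x : Fin 3 → ℝ} (hx : ∀ i, x i ∈ Ioo (0 : ℝ) 1) :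
    (1 : ℝ) - (x 0 * x 1 * x 2) ^ 2 ≠ 0 := by
  have h := box_t_mem hx
  have : (x 0 * x 1 * x 2) ^ 2 < 1 := pow_lt_one₀ h.1.le h.2 (by norm_num)
  linarith

/-- `sectorFun P` in `MvPolynomial` clothing (for `isSemialgebraicFunOn_aeval_div_aeval`). -/
theorem sectorFun_eq (P : Polynomial ℚ) (x : Fin 3 → ℝ) :
    sectorFun P x =
      MvPolynomial.aeval x (Polynomial.aeval
          (MvPolynomial.X 0 * MvPolynomial.X 1 * MvPolynomial.X 2 : MvPolynomial (Fin 3) ℚ) P) /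
        MvPolynomial.aeval x
          (1 - (MvPolynomial.X 0 * MvPolynomial.X 1 * MvPolynomial.X 2 : MvPolynomial (Fin 3) ℚ) ^ 2) := by
  rw [← Polynomial.aeval_algHom_apply]
  simp [sectorFun]

/-- Integrability of every sector integrand (finite sum of the in-tree Hurwitz box integrands). -/
theorem integrableOn_sectorFun (P : Polynomial ℚ) :
    IntegrableOn (sectorFun P) {x : Fin 3 → ℝ | ∀ i, x i ∈ Set.Ioo (0:ℝ) 1} volume := by
  have hterm : ∀ j : ℕ, IntegrableOn
      (fun x : Fin 3 → ℝ => (x 0 * x 1 * x 2) ^ j / (1 - (x 0 * x 1 * x 2) ^ 2))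
      {x : Fin 3 → ℝ | ∀ i, x i ∈ Set.Ioo (0:ℝ) 1} volume := by
    intro j
    have h := BoxIntegral.integrableOn_box_prod_pow_div_one_sub_prod_pow (n := 3) (by norm_num)
      (m := 2) (by norm_num) j
    simp only [Fin.prod_univ_three] at h
    exact h
  have hsum : IntegrableOn (fun x : Fin 3 → ℝ => ∑ j ∈ Finset.range (P.natDegree + 1),
      ((P.coeff j : ℚ) : ℝ) * ((x 0 * x 1 * x 2) ^ j / (1 - (x 0 * x 1 * x 2) ^ 2)))
      {x : Fin 3 → ℝ | ∀ i, x i ∈ Set.Ioo (0:ℝ) 1} volume :=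
    integrable_finset_sum _ fun j _ => (hterm j).const_mul _
  refine hsum.congr_fun (fun x _ => ?_) (BoxIntegral.measurableSet_box 3)
  simp only [sectorFun, Polynomial.aeval_eq_sum_range, Finset.sum_div, Algebra.smul_def, eq_ratCast]
  refine Finset.sum_congr rfl fun j _ => ?_
  ring

/-- **(E0) the one constructor.** The canonical sector representation of `P`. -/
def sectorRep (P : Polynomial ℚ) : KZ.IntegralRep 3 where
  domain := {x | ∀ i, x i ∈ Set.Ioo (0:ℝ) 1}
  integrand := sectorFun P
  isSemialgebraic_domain := KZ.isSemialgebraic_box 3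
  isSemialgebraicFunOn_integrand := by
    refine (isSemialgebraicFunOn_aeval_div_aeval (KZ.isSemialgebraic_box 3)
      (Polynomial.aeval (MvPolynomial.X 0 * MvPolynomial.X 1 * MvPolynomial.X 2 :
        MvPolynomial (Fin 3) ℚ) P)
      (1 - (MvPolynomial.X 0 * MvPolynomial.X 1 * MvPolynomial.X 2 : MvPolynomial (Fin 3) ℚ) ^ 2)
      ?_).congr ?_
    · intro x hx
      have h := one_sub_sq_ne_zero hx
      simpa using h
    · intro x _
      exact (sectorFun_eq P x).symm
  integrableOn := integrableOn_sectorFun P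

theorem isSectorRep_sectorRep (P : Polynomial ℚ) : IsSectorRep (sectorRep P) P :=
  ⟨rfl, fun _ _ => rfl⟩

theorem isSectorRep_sectorRep_of_eq {P Q : Polynomial ℚ} (h : P = Q) :
    IsSectorRep (sectorRep P) Q := h ▸ isSectorRep_sectorRep P

theorem sectorRepExists_holds : SectorRepExists := fun P => ⟨sectorRep P, isSectorRep_sectorRep P⟩

/-- **(E1)** additivity: one `integrandAddRel` instance. -/
theorem sectorAdd_holds : SectorAdd := by
  intro P Q r rP rQ hr hP hQ
  refine KZ.integrandAddRel_subset_relations ⟨3, r, rP, rQ, ?_, ?_, ?_, rfl⟩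
  · rw [hP.1, hr.1]
  · rw [hQ.1, hr.1]
  · intro x hx
    have hxP : x ∈ rP.domain := by rw [hP.1]; rw [hr.1] at hx; exact hx
    have hxQ : x ∈ rQ.domain := by rw [hQ.1]; rw [hr.1] at hx; exact hx
    rw [Pi.add_apply, hr.2 hx, hP.2 hxP, hQ.2 hxQ]
    simp only [sectorFun, map_add, add_div]

/-- **(E2)** flattening: one dilation `m = k + 1` with constant target (card A). -/
theorem sectorFlatten_holds : SectorFlatten := by
  intro k q r r' hr hr'
  refine KZ.changeOfVariablesRel_subset_relations
    (dilationMove_holds 3 (k + 1) (by omega) r r' hr.1 hr'.1 fun x hx => ?_)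
  have hx' : ∀ i, x i ∈ Ioo (0 : ℝ) 1 := by rw [hr.1] at hx; exact hx
  have hy' : ∀ i, (fun i => x i ^ (k + 1)) i ∈ Ioo (0 : ℝ) 1 := fun i =>
    ⟨pow_pos (hx' i).1 _, pow_lt_one₀ (hx' i).1.le (hx' i).2 (by omega)⟩
  have hy : (fun i => x i ^ (k + 1)) ∈ r'.domain := by rw [hr'.1]; exact hy'
  have h1 := one_sub_sq_ne_zero hx'
  have h2 : (1 : ℝ) - (x 0 ^ (k + 1) * x 1 ^ (k + 1) * x 2 ^ (k + 1)) ^ 2 ≠ 0 :=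
    one_sub_sq_ne_zero hy'
  rw [hr.2 hx, hr'.2 hy, Fin.prod_univ_three]
  simp only [sectorFun, map_mul, map_sub, map_pow, map_one, Polynomial.aeval_C, Polynomial.aeval_X,
    eq_ratCast, Nat.add_sub_cancel, mul_div_cancel_right₀ _ h1, mul_div_cancel_right₀ _ h2]
  push_cast
  ring

/-- **(E3)** doubling: one dilation `m = 2`, target `q/(1 − t)`. -/
theorem sectorDouble_holds : SectorDouble := by
  intro q r r' hr hr'
  refine KZ.changeOfVariablesRel_subset_relations
    (dilationMove_holds 3 2 (by omega) r r' hr.1 hr'.1 fun x hx => ?_)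
  have hx' : ∀ i, x i ∈ Ioo (0 : ℝ) 1 := by rw [hr.1] at hx; exact hx
  have hy' : ∀ i, (fun i => x i ^ 2) i ∈ Ioo (0 : ℝ) 1 := fun i =>
    ⟨pow_pos (hx' i).1 _, pow_lt_one₀ (hx' i).1.le (hx' i).2 (by omega)⟩
  have hy : (fun i => x i ^ 2) ∈ r'.domain := by rw [hr'.1]; exact hy'
  have ht := box_t_mem hx'
  have h1 := one_sub_sq_ne_zero hx'
  have h1' : (1 : ℝ) - x 0 * x 1 * x 2 ≠ 0 := by linarith [ht.2]
  have h1'' : (1 : ℝ) + x 0 * x 1 * x 2 ≠ 0 := by linarith [ht.1]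
  have h2 : (1 : ℝ) + (x 0 * x 1 * x 2) ^ 2 ≠ 0 := by positivity
  have hm : (2 : ℕ) - 1 = 1 := rfl
  rw [hr.2 hx, hr'.2 hy, Fin.prod_univ_three]
  simp only [sectorFun, map_mul, map_add, map_pow, map_one, Polynomial.aeval_C, Polynomial.aeval_X,
    eq_ratCast, hm, pow_one]
  have e1 : (1 : ℝ) - (x 0 * x 1 * x 2) ^ 2 = (1 - x 0 * x 1 * x 2) * (1 + x 0 * x 1 * x 2) := by ring
  have e2 : (1 : ℝ) - (x 0 ^ 2 * x 1 ^ 2 * x 2 ^ 2) ^ 2 =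
      (1 - x 0 * x 1 * x 2) * (1 + x 0 * x 1 * x 2) * (1 + (x 0 * x 1 * x 2) ^ 2) := by ring
  have e3 : (1 : ℝ) + x 0 ^ 2 * x 1 ^ 2 * x 2 ^ 2 = 1 + (x 0 * x 1 * x 2) ^ 2 := by ring
  rw [e1, e2, e3]
  push_cast
  field_simp
  ring

/-! #### The parity ladder on canonical representations -/

/-- Normal form of the CANONICAL representation of `P`. -/
def HasNF (P : Polynomial ℚ) : Prop :=
  ∃ c b : ℚ, KZ.of (sectorRep P) - KZ.of (sectorRep (nfPoly c b)) ∈ KZ.relations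

theorem eq_rel {P Q : Polynomial ℚ} (h : P = Q) :
    KZ.of (sectorRep P) - KZ.of (sectorRep Q) ∈ KZ.relations := by
  subst h
  simp [KZ.relations.zero_mem]

theorem add_rel (P Q R : Polynomial ℚ) (h : R = P + Q) :
    KZ.of (sectorRep R) - KZ.of (sectorRep P) - KZ.of (sectorRep Q) ∈ KZ.relations :=
  sectorAdd_holds P Q _ _ _ (isSectorRep_sectorRep_of_eq h) (isSectorRep_sectorRep P)
    (isSectorRep_sectorRep Q)

theorem flat_rel (k : ℕ) (q : ℚ) :
    KZ.of (sectorRep (C (q * ((k : ℚ) + 1) ^ 3) * X ^ k * (1 - X ^ 2))) -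
      KZ.of (sectorRep (C q * (1 - X ^ 2))) ∈ KZ.relations :=
  sectorFlatten_holds k q _ _ (isSectorRep_sectorRep _) (isSectorRep_sectorRep _)

theorem dbl_rel (q : ℚ) :
    KZ.of (sectorRep (C (8 * q) * X)) - KZ.of (sectorRep (C q * (1 + X))) ∈ KZ.relations :=
  sectorDouble_holds q _ _ (isSectorRep_sectorRep _) (isSectorRep_sectorRep _)

theorem nfPoly_add (c b c' b' : ℚ) : nfPoly (c + c') (b + b') = nfPoly c b + nfPoly c' b' := by
  simp only [nfPoly, map_add]
  ring

theorem nfPoly_zero_right (c : ℚ) : nfPoly c 0 = C c * (1 - X ^ 2) := by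
  simp [nfPoly]

theorem nfPoly_zero_left (b : ℚ) : nfPoly 0 b = C b * (1 + X) := by
  simp [nfPoly]

theorem hasNF_add {P Q : Polynomial ℚ} (hP : HasNF P) (hQ : HasNF Q) : HasNF (P + Q) := by
  obtain ⟨c, b, hP⟩ := hP
  obtain ⟨c', b', hQ⟩ := hQ
  refine ⟨c + c', b + b', ?_⟩
  have hA := add_rel P Q (P + Q) rfl
  have hD := add_rel (nfPoly c b) (nfPoly c' b') (nfPoly (c + c') (b + b')) (nfPoly_add c b c' b')
  have : KZ.of (sectorRep (P + Q)) - KZ.of (sectorRep (nfPoly (c + c') (b + b'))) =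
      (KZ.of (sectorRep (P + Q)) - KZ.of (sectorRep P) - KZ.of (sectorRep Q)) +
        (KZ.of (sectorRep P) - KZ.of (sectorRep (nfPoly c b))) +
        (KZ.of (sectorRep Q) - KZ.of (sectorRep (nfPoly c' b'))) -
        (KZ.of (sectorRep (nfPoly (c + c') (b + b'))) - KZ.of (sectorRep (nfPoly c b)) -
          KZ.of (sectorRep (nfPoly c' b'))) := by abel
  rw [this]
  exact KZ.relations.sub_mem (KZ.relations.add_mem (KZ.relations.add_mem hA hP) hQ) hD

/-- Base `j = 1`: `⟦q t⟧ ≡ ⟦(q/8)(1+t)⟧` — doubling. -/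
theorem hasNF_X (q : ℚ) : HasNF (C q * X ^ 1) := by
  refine ⟨0, q / 8, ?_⟩
  have h1 : C q * X ^ 1 = C (8 * (q / 8)) * X := by
    rw [mul_div_cancel₀ q (by norm_num : (8 : ℚ) ≠ 0), pow_one]
  have h2 : C (q / 8) * (1 + X) = nfPoly 0 (q / 8) := (nfPoly_zero_left _).symm
  have hA := eq_rel h1
  have hB := dbl_rel (q / 8)
  have hC := eq_rel h2
  have : KZ.of (sectorRep (C q * X ^ 1)) - KZ.of (sectorRep (nfPoly 0 (q / 8))) =
      (KZ.of (sectorRep (C q * X ^ 1)) - KZ.of (sectorRep (C (8 * (q / 8)) * X))) +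
        (KZ.of (sectorRep (C (8 * (q / 8)) * X)) - KZ.of (sectorRep (C (q / 8) * (1 + X)))) +
        (KZ.of (sectorRep (C (q / 8) * (1 + X))) - KZ.of (sectorRep (nfPoly 0 (q / 8)))) := by abel
  rw [this]
  exact KZ.relations.add_mem (KZ.relations.add_mem hA hB) hC

/-- Base `j = 0`: `⟦q/(1−t²)⟧ ≡ ⟦(7q/8)(1+t)/(1−t²)⟧` — `q = q(1+t) − qt` and doubling. -/
theorem hasNF_one (q : ℚ) : HasNF (C q * X ^ 0) := by
  refine ⟨0, 7 * q / 8, ?_⟩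
  -- A: [q(1+X)] - [q X^0] - [q X^1]
  have hA := add_rel (C q * X ^ 0) (C q * X ^ 1) (C q * (1 + X)) (by ring)
  -- B: [q X^1] - [nf 0 (q/8)]  (the explicit chain of `hasNF_X`)
  have h1 : C q * X ^ 1 = C (8 * (q / 8)) * X := by
    rw [mul_div_cancel₀ q (by norm_num : (8 : ℚ) ≠ 0), pow_one]
  have hB1 := eq_rel h1
  have hB2 := dbl_rel (q / 8)
  have hB3 := eq_rel (nfPoly_zero_left (q / 8)).symm
  -- D: [q(1+X)] - [nf 0 (7q/8)] - [nf 0 (q/8)]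
  have hD := add_rel (nfPoly 0 (7 * q / 8)) (nfPoly 0 (q / 8)) (C q * (1 + X)) (by
    rw [nfPoly_zero_left, nfPoly_zero_left, ← add_mul, ← Polynomial.C_add]
    congr 2
    ring)
  have : KZ.of (sectorRep (C q * X ^ 0)) - KZ.of (sectorRep (nfPoly 0 (7 * q / 8))) =
      -(KZ.of (sectorRep (C q * (1 + X))) - KZ.of (sectorRep (C q * X ^ 0)) -
          KZ.of (sectorRep (C q * X ^ 1))) +
        (KZ.of (sectorRep (C q * (1 + X))) - KZ.of (sectorRep (nfPoly 0 (7 * q / 8))) -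
          KZ.of (sectorRep (nfPoly 0 (q / 8)))) -
        ((KZ.of (sectorRep (C q * X ^ 1)) - KZ.of (sectorRep (C (8 * (q / 8)) * X))) +
          (KZ.of (sectorRep (C (8 * (q / 8)) * X)) - KZ.of (sectorRep (C (q / 8) * (1 + X)))) +
          (KZ.of (sectorRep (C (q / 8) * (1 + X))) - KZ.of (sectorRep (nfPoly 0 (q / 8))))) := by
    abel
  rw [this]
  exact KZ.relations.sub_mem (KZ.relations.add_mem (KZ.relations.neg_mem hA) hD)
    (KZ.relations.add_mem (KZ.relations.add_mem hB1 hB2) hB3)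

/-- Ladder step `j → j + 2`: `t^j = t^{j+2} + t^j (1 − t²)` and flattening of `t^j (1−t²)`. -/
theorem hasNF_step (q : ℚ) (j : ℕ) (h : HasNF (C q * X ^ j)) : HasNF (C q * X ^ (j + 2)) := by
  obtain ⟨c, b, hB⟩ := h
  set q' : ℚ := q / ((j : ℚ) + 1) ^ 3 with hq'
  refine ⟨c - q', b, ?_⟩
  have hj : ((j : ℚ) + 1) ^ 3 ≠ 0 := by positivity
  -- A: [q X^j] - [q X^(j+2)] - [q X^j (1 - X^2)]
  have hA := add_rel (C q * X ^ (j + 2)) (C q * X ^ j * (1 - X ^ 2)) (C q * X ^ j) (by ring)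
  -- F: [q X^j (1-X^2)] - [nf q' 0]  (flattening, through two polynomial identities)
  have h1 : C q * X ^ j * (1 - X ^ 2) = C (q' * ((j : ℚ) + 1) ^ 3) * X ^ j * (1 - X ^ 2) := by
    rw [hq', div_mul_cancel₀ q hj]
  have hF1 := eq_rel h1
  have hF2 := flat_rel j q'
  have hF3 := eq_rel (nfPoly_zero_right q').symm
  -- D: [nf c b] - [nf (c - q') b] - [nf q' 0]
  have hD := add_rel (nfPoly (c - q') b) (nfPoly q' 0) (nfPoly c b) (by
    rw [← nfPoly_add]; congr 1 <;> ring)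
  have : KZ.of (sectorRep (C q * X ^ (j + 2))) - KZ.of (sectorRep (nfPoly (c - q') b)) =
      -(KZ.of (sectorRep (C q * X ^ j)) - KZ.of (sectorRep (C q * X ^ (j + 2))) -
          KZ.of (sectorRep (C q * X ^ j * (1 - X ^ 2)))) +
        (KZ.of (sectorRep (C q * X ^ j)) - KZ.of (sectorRep (nfPoly c b))) -
        ((KZ.of (sectorRep (C q * X ^ j * (1 - X ^ 2))) -
            KZ.of (sectorRep (C (q' * ((j : ℚ) + 1) ^ 3) * X ^ j * (1 - X ^ 2)))) +
          (KZ.of (sectorRep (C (q' * ((j : ℚ) + 1) ^ 3) * X ^ j * (1 - X ^ 2))) -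
            KZ.of (sectorRep (C q' * (1 - X ^ 2)))) +
          (KZ.of (sectorRep (C q' * (1 - X ^ 2))) - KZ.of (sectorRep (nfPoly q' 0)))) +
        (KZ.of (sectorRep (nfPoly c b)) - KZ.of (sectorRep (nfPoly (c - q') b)) -
          KZ.of (sectorRep (nfPoly q' 0))) := by
    abel
  rw [this]
  exact KZ.relations.add_mem
    (KZ.relations.sub_mem (KZ.relations.add_mem (KZ.relations.neg_mem hA) hB)
      (KZ.relations.add_mem (KZ.relations.add_mem hF1 hF2) hF3)) hD

/-- Every monomial has a normal form (two-step induction on the exponent). -/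
theorem hasNF_monomial (q : ℚ) : ∀ j : ℕ, HasNF (C q * X ^ j) := by
  intro j
  induction j using Nat.twoStepInduction with
  | zero => exact hasNF_one q
  | one => exact hasNF_X q
  | more j ih _ => exact hasNF_step q j ih

/-- Every `P ∈ ℚ[t]` has a normal form (additivity). -/
theorem hasNF (P : Polynomial ℚ) : HasNF P := by
  induction P using Polynomial.induction_on' with
  | add p q hp hq => exact hasNF_add hp hq
  | monomial j a =>
    rw [← Polynomial.C_mul_X_pow_eq_monomial]
    exact hasNF_monomial a j

/-- `NormalFormExists`, PROVED (congruence moves an arbitrary sector rep to the canonical one). -/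
theorem normalFormExists_holds : NormalFormExists := by
  intro P r hr
  obtain ⟨c, b, h⟩ := hasNF P
  refine ⟨c, b, sectorRep (nfPoly c b), isSectorRep_sectorRep _, ?_⟩
  have hcongr : KZ.of r - KZ.of (sectorRep P) ∈ KZ.relations :=
    KZ.of_sub_of_mem_relations_of_eqOn (r := r) (r' := sectorRep P) (by rw [hr.1]; rfl) hr.2
  have : KZ.of r - KZ.of (sectorRep (nfPoly c b)) =
      (KZ.of r - KZ.of (sectorRep P)) + (KZ.of (sectorRep P) - KZ.of (sectorRep (nfPoly c b))) := by
    abel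
  rw [this]
  exact KZ.relations.add_mem hcongr h

/-- **The crux, PROVED along card B** (`apery_of_nf` with (E0), (E1) and the ladder). -/
theorem aperySectorThreeTwo_holds : AperySectorThreeTwo :=
  apery_of_nf sectorRepExists_holds sectorAdd_holds normalFormExists_holds

end Proofs

/-! ## Card C — level-two-tower (Transfer): the generic-dimension level-2 sector -/

/-- **C⁺ (LevelTwoTower).** For every dimension `n ≥ 2`: if `ζ(n) ∉ ℚ` then Conjecture 1 holds on
the `(n, 2)` box sector. Same proof text as card B with `∏ i, x i` for `x 0 * x 1 * x 2`
(flattening: `[q (k+1)ⁿ tᵏ] ∼ [q]`; doubling: `[2ⁿ q t/(1−t²)] ∼ [q/(1−t)]`; value of the normal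
form `c + b ζ(n)` by `setIntegral_box_one_div_one_sub_prod_eq_zetaValue`). -/
def LevelTwoTower : Prop :=
  ∀ (n : ℕ), 2 ≤ n → Irrational (zetaValue n) →
    ∀ (r r' : KZ.IntegralRep n) (P P' : Polynomial ℚ),
      r.domain = {x | ∀ i, x i ∈ Set.Ioo (0:ℝ) 1} → r'.domain = {x | ∀ i, x i ∈ Set.Ioo (0:ℝ) 1} →
      Set.EqOn r.integrand (fun x => Polynomial.aeval (∏ i, x i) P / (1 - (∏ i, x i) ^ 2)) r.domain →
      Set.EqOn r'.integrand (fun x => Polynomial.aeval (∏ i, x i) P' / (1 - (∏ i, x i) ^ 2)) r'.domain →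
      r.value = r'.value → KZ.Equivalent r r'

/-- `n = 3`: the crux, unconditionally (Apéry, in tree). -/
theorem apery_of_tower (h : LevelTwoTower) : AperySectorThreeTwo := by
  intro r r' P P' hr hr' hi hi' hv
  refine h 3 (by norm_num) Apery.irrational_zeta_three r r' P P' hr hr' ?_ ?_ hv
  · intro x hx
    rw [hi hx]
    simp only [Fin.prod_univ_three]
  · intro x hx
    rw [hi' hx]
    simp only [Fin.prod_univ_three]

/-- `n = 2k`: every even-weight level-2 sector, unconditionally (Lindemann, in tree:
`transcendental_zetaValue_two_mul`). -/
theorem evenSector_of_tower (h : LevelTwoTower) {k : ℕ} (hk : k ≠ 0) :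
    ∀ (r r' : KZ.IntegralRep (2 * k)) (P P' : Polynomial ℚ),
      r.domain = {x | ∀ i, x i ∈ Set.Ioo (0:ℝ) 1} → r'.domain = {x | ∀ i, x i ∈ Set.Ioo (0:ℝ) 1} →
      Set.EqOn r.integrand (fun x => Polynomial.aeval (∏ i, x i) P / (1 - (∏ i, x i) ^ 2)) r.domain →
      Set.EqOn r'.integrand (fun x => Polynomial.aeval (∏ i, x i) P' / (1 - (∏ i, x i) ^ 2)) r'.domain →
      r.value = r'.value → KZ.Equivalent r r' :=
  h (2 * k) (by omega)
    (Literature.Barriers.KontsevichZagierPeriods.transcendental_zetaValue_two_mul hk).irrational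

end Summit.KontsevichZagierPeriods.KontsevichZagierPeriods.Cruxes.AperySectorThreeTwo.Ideator3
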